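import Summits.BirchSwinnertonDyer.BirchSwinnertonDyer.Theorems.GenusKolyvaginAtTwoMinimalTwinBSDTwoSwappedPairFrame
import HarnessLib

/-!
# Route `GenusKolyvaginAtTwo`, crux U₂ `MinimalTwinBSDTwo` (stmt-BirchSwinnertonDyer-22985), LINE 23 «twin_swap» (pen bsd-idea-1 g23),
# stub S3 `SwappedPairDescentAtTwo` on its method slice — THE SWAPPED PAIR SANDWICH:
# `Ш(E/K)[2^∞] = 0` for the RANK-ONE `2`-Selmer-minimal Heegner member whose twin is `2`-Selmer-TRIVIAL, inside the genus budget

Seat `bsd-line-gk2-p2` g23 (PROVER seat 2/3, cell `bsd-f1-sign2`), `--supports stmt-BirchSwinnertonDyer-22985` (helper; closes nothing).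
THEOREMS ONLY (no definition, no named fact, no `sorry`); standard axioms.  **BSD is NOT proved by this file; U₂ / hTw is NOT proved;
no item is closed.**

THE SWAP (LINE 23, `Cruxes/MinimalTwinBSDTwo`, pen card `twin_swap.md` v1.1).  In the route's `closes` the one absolute `2`-adic input
on the Kolyvagin side is hTw = `BSD₂` of the RANK-ONE minimal twin.  LINE 23 re-anchors: the rank-one curve `E` (`#Sel₂(E) = 2`, odd
Tamagawa product) is itself the Heegner-carrying member (`ε = −1`) of a SECOND pair `(E, E^(d_K))` whose twin is of rank `0` with
`#Sel₂(E^(d_K)) = 1`.  THIS FILE proves the K-side exactness input of that swapped pair at depth zero, UNCONDITIONALLY: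

* §1 `natCard_primaryComponent_eq_of_addEquiv` — bookkeeping: an additive isomorphism carrying a subgroup onto a subgroup preserves the
  order of their `p`-primary components.
* §2 **`natCard_primaryComponent_sha_baseChange_two_eq_one_of_swappedPair`** — `W/ℚ` globally minimal with `C(W)` odd; `K` imaginary
  quadratic, `d_K` odd, Heegner for `N_W`; `E(K)[2] = 0`; `rank E(ℚ) ≥ 1` and `#Sel₂(E) = 2`; an elliptic `ℚ`-model `Wd ≅ E^(d_K)` with
  `#Sel₂(Wd) = 1`; and the GENUS BUDGET `(Δ_W < 0 ∧ ord₂ C(Wd) ≤ 1) ∨ ord₂ C(Wd) = 0`.  Then **`Ш(E/K)[2^∞]` is finite of order `1`**.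
  Mechanism: gk2-p3 g27's sign-free pair sandwich `natCard_sha_dvd_pow_of_pair_of_frame` READ WITH THE `2`-SELMER-TRIVIAL TWIN `T₀ = W^(d_K)`
  AS BASE (its twist `T₀^(d_K) = W^(d_K²) ≅ W` is the rank-one member): both `ℚ`-sides `Ш(T₀/ℚ)[2^∞]`, `Ш(W/ℚ)[2^∞]` vanish
  (`#Sel₂ = 1`; `#Sel₂ = 2` with rank `1`), the anti-invariant frame point of `T₀(K)` is the twist `τ(P)` of a rational point `P ∈ E(ℚ)` of
  infinite order (Silverman X.5.4, `QuadraticDescent.twistMap`, `σ ∘ τ = −τ`), the relaxed indices are the route's budgets (twin side by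
  name; curve side = the model-free core `relIndex_sha_relaxed_le_prod_natCard_twoTorsion` on the model `W^(d_K²) = D • W`); so
  `2 · #Ш(T₀/K)[2^∞] ≤ 4`, Cassels–Tate squareness gives `1`, and the `Ш`-level twist transport `Ψ` (gk2-p4 g22) carries it to `E/K`.
* §3 `…_of_hasSurjectiveModNGaloisRep_two` — the same with `E(K)[2] = 0` discharged from `ρ̄_{E,2}` onto (habitat form).

CONSEQUENCE FOR LINE 23 (census): inside the budget the swapped frame has `Ш(E/K)[2^∞] = 0`, so Kolyvagin EXACTNESS `#Ш(E/K)[2^∞] =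
4^(M₀)` holds iff `M₀ = 0` (`y_K ∉ 2E(K)`, the `n = 1` witness of stub S2 — REVFALS-g23: 41/41 odd-Tamagawa cells); stub S3 then reduces
to the `ε = −1` exact descent at `M₀ = 0` (sequel file `…SwappedDescent`).  Beyond print: no (Kramer 1981 / Gross 1991 §5 descent algebra,
re-assembled).  BSD is NOT proved; nothing is closed.

References: [Kramer1981] Thm. 1, §2 Prop. 3; [GrossLMS1991] §5 (5.1)–(5.3); [SilvermanAEC2009] X.4.2, X.5 Cor. 5.4, Exercise 10.16;
[MilneADT2006] I Rem. 3.7, Thm. 6.13.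
-/

set_option autoImplicit false
set_option linter.dupNamespace false -- `Summit.<P>.<Sub>` repeats `BirchSwinnertonDyer` (D-0017)

noncomputable section

open scoped Classical

namespace Summit.BirchSwinnertonDyer.BirchSwinnertonDyer.Theorems.GenusExact.TwinSwap

open Literature.NumberTheory.EllipticCurves Literature.NumberTheory.GaloisRepresentations WeierstrassCurve NumberField
  IsDedekindDomain Field AddSubgroup
open Summit.BirchSwinnertonDyer.Rank1Residual Literature.Barriers.BirchSwinnertonDyer
open Summit.BirchSwinnertonDyer.BirchSwinnertonDyer.Theorems.GenusExact.PlusDescent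
open Summit.BirchSwinnertonDyer.BirchSwinnertonDyer.Theorems.GenusExact.RegularPlusDescent (archimedeanBit_sha_comap_resBaseChange
  relIndex_sha_comap_resBaseChange_le_of_arch relIndex_sha_comap_resBaseChange_twin_le_two_pow_succ_of_arch)


/-! ## §1 The swapped pair sandwich over `ℚ` -/

section Swapped

variable (W : WeierstrassCurve ℚ) [W.IsElliptic] [W.IsGloballyMinimal]
variable (K : Type) [Field K] [NumberField K]

/-- **THE SWAPPED PAIR SANDWICH: `Ш(E/K)[2^∞] = 0` for the rank-one `2`-Selmer-minimal Heegner member with `2`-Selmer-trivial twin,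
inside the genus budget.**  `W/ℚ` globally minimal with `C(W)` odd; `K` imaginary quadratic, `d_K` odd, Heegner for `N_W`; `E(K)[2] = 0`;
`rank E(ℚ) ≥ 1` and `#Sel₂(E/ℚ) = 2`; `Wd = Cd • W^(d_K)` elliptic with `#Sel₂(Wd/ℚ) = 1`; budget `(Δ_W < 0 ∧ ord₂ C(Wd) ≤ 1) ∨ ord₂ C(Wd) = 0`.
Then `Ш(E/K)[2^∞]` is finite and **`#Ш(E/K)[2^∞] = 1`**.  Proof: the sign-free pair sandwich `natCard_sha_dvd_pow_of_pair_of_frame` for the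
BASE `T₀ = W^(d_K)` (rank `0`, `Ш(T₀/ℚ)[2^∞] = 0`, `ℚ`-side exponent `m = 0`) whose twist `T₀^(d_K) = D • W` is the rank-one member
(`Ш[2^∞] = 0` by `#Sel₂ = 2`); frame point = the twist of a rational point of `E` of infinite order (`QuadraticDescent.twistMap`,
`σ ∘ τ = −τ`); budgets = the route's twin-side budget for `T₀` and the model-free relaxed budget for `D • W`; then the `Ш`-level twist transport
`Ψ : H¹(K, T₀) ≃ H¹(K, E)` (`exists_galH1_twistTransport`).  Unconditional; no Kolyvagin prime, no Q2, no print fact.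
[cite: Kramer1981, Thm. 1 and §2 Prop. 3] [cite: GrossLMS1991, §5 (5.1)–(5.3)] [cite: SilvermanAEC2009, X.5 Cor. 5.4, Exercise 10.16, Thm. X.4.2] -/
theorem finite_and_natCard_primaryComponent_sha_baseChange_two_eq_one_of_swappedPair
    (hT : Odd W.tamagawaProduct) (hIQ : IsImaginaryQuadratic K) (hodd : Odd (NumberField.discr K))
    (hHe : SatisfiesHeegnerHypothesis (W.conductorNorm ℤ) K)
    (h2K : ∀ P : (W.baseChange K).toAffine.Point, (2 : ℤ) • P = 0 → P = 0)
    (hrk : 1 ≤ W.mordellWeilRank) (hSel : Nat.card (W.selmerGroup 2) = 2)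
    {Wd : WeierstrassCurve ℚ} [Wd.IsElliptic] (Cd : VariableChange ℚ) (hWd : Cd • W.quadraticTwist (NumberField.discr K : ℚ) = Wd)
    (hSel1 : Nat.card (Wd.selmerGroup 2) = 1)
    (hbudget : (W.Δ < 0 ∧ padicValNat 2 Wd.tamagawaProduct ≤ 1) ∨ padicValNat 2 Wd.tamagawaProduct = 0) :
    Finite (AddCommGroup.primaryComponent (↥(W.baseChange K).sha) 2) ∧
      Nat.card (AddCommGroup.primaryComponent (↥(W.baseChange K).sha) 2) = 1 := by
  haveI : Fact (Nat.Prime 2) := ⟨Nat.prime_two⟩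
  haveI : NeZero (2 : ℚ) := ⟨two_ne_zero⟩
  have h2 : Module.finrank ℚ K = 2 := hIQ.1
  have hdK : (NumberField.discr K : ℚ) ≠ 0 := by exact_mod_cast NumberField.discr_ne_zero K
  haveI hT₀ell : (W.quadraticTwist (NumberField.discr K : ℚ)).IsElliptic := W.isElliptic_quadraticTwist hdK
  haveI hX'ell : ((W.quadraticTwist (NumberField.discr K : ℚ)).quadraticTwist (NumberField.discr K : ℚ)).IsElliptic :=
    (W.quadraticTwist (NumberField.discr K : ℚ)).isElliptic_quadraticTwist hdK
  haveI hT₀Kell : ((W.quadraticTwist (NumberField.discr K : ℚ)).baseChange K).IsElliptic :=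
    inferInstanceAs (((W.quadraticTwist (NumberField.discr K : ℚ)).map (algebraMap ℚ K)).IsElliptic)
  -- `X' = T₀^(d_K) = D • W`, `Aut(K/ℚ) = {1, τ}`, `θ = √d_K`
  obtain ⟨D, hD⟩ := exists_quadraticTwist_quadraticTwist_eq_smul W hdK
  obtain ⟨τ, θ, hτ1, hθQ, hθ2, hτθ, -⟩ := exists_gal_ne_one_sqrt_discr K h2
  -- ### (a) the rank-one member: `rank E(ℚ) = 1`, a rational point of infinite order, `#Sel₂(X') = 2`, `Ш(X'/ℚ)[2^∞] = 0`
  obtain ⟨hrkW1, -, -⟩ := rank_eq_one_and_sha_primary_eq_zero_of_natCard_selmerGroup_eq_two W hSel hrk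
  obtain ⟨Q, hQ⟩ := exists_not_isOfFinAddOrder_of_one_le_mordellWeilRank W hrk
  have hSelX : Nat.card (((W.quadraticTwist (NumberField.discr K : ℚ)).quadraticTwist (NumberField.discr K : ℚ)).selmerGroup 2) = 2 := by
    have h := natCard_selmerGroup_smul W D (n := 2) two_ne_zero
    simp only [Nat.cast_ofNat] at h
    rw [← hD] at h
    exact h.trans hSel
  have hrkX : ((W.quadraticTwist (NumberField.discr K : ℚ)).quadraticTwist (NumberField.discr K : ℚ)).mordellWeilRank = 1 := by
    have h : (D • W).mordellWeilRank = W.mordellWeilRank := mordellWeilRank_variableChange_holds W D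
    rw [← hD] at h
    rw [h, hrkW1]
  obtain ⟨-, -, hT0⟩ := rank_eq_one_and_sha_primary_eq_zero_of_natCard_selmerGroup_eq_two
    ((W.quadraticTwist (NumberField.discr K : ℚ)).quadraticTwist (NumberField.discr K : ℚ)) hSelX (by rw [hrkX])
  -- ### (b) the base `T₀`: `#Sel₂(T₀) = 1`, rank `0`, `Ш(T₀/ℚ)[2^∞] = 0`
  have hSelT : Nat.card ((W.quadraticTwist (NumberField.discr K : ℚ)).selmerGroup ((2 : ℕ) : ℤ)) = 1 := by
    have h := natCard_selmerGroup_smul (W.quadraticTwist (NumberField.discr K : ℚ)) Cd (n := 2) two_ne_zero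
    rw [hWd] at h
    rw [← h, Nat.cast_ofNat]
    exact hSel1
  obtain ⟨hrkT0, -, -⟩ := rank_eq_zero_and_torsionBy_eq_bot_and_sha_inf_torsionBy_eq_bot_of_natCard_selmerGroup_eq_one
    (W.quadraticTwist (NumberField.discr K : ℚ)) 2 hSelT
  have hbotT : AddCommGroup.primaryComponent (↥(W.quadraticTwist (NumberField.discr K : ℚ)).sha) 2 = ⊥ :=
    primaryComponent_sha_eq_bot_of_natCard_selmerGroup_eq_one (W.quadraticTwist (NumberField.discr K : ℚ)) 2 hSelT
  haveI hfinT : Finite (AddCommGroup.primaryComponent (↥(W.quadraticTwist (NumberField.discr K : ℚ)).sha) 2) := by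
    rw [hbotT]; infer_instance
  have hexp : ∀ a ∈ AddCommGroup.primaryComponent (↥(W.quadraticTwist (NumberField.discr K : ℚ)).sha) 2, 2 ^ 0 • a = 0 := by
    intro a ha
    rw [hbotT, AddSubgroup.mem_bot] at ha
    rw [ha, smul_zero]
  have h4 : Nat.card (AddSubgroup.torsionBy (↥(W.quadraticTwist (NumberField.discr K : ℚ)).sha) ((2 : ℕ) : ℤ)) ≤ 4 := by
    have h1 : Nat.card (AddSubgroup.torsionBy (↥(W.quadraticTwist (NumberField.discr K : ℚ)).sha) ((2 : ℕ) : ℤ)) = 1 := by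
      rw [Nat.card_eq_one_iff_unique]
      refine ⟨⟨fun a b ↦ Subtype.ext ?_⟩, ⟨0⟩⟩
      have hmem : ∀ c : AddSubgroup.torsionBy (↥(W.quadraticTwist (NumberField.discr K : ℚ)).sha) ((2 : ℕ) : ℤ),
          (c : ↥(W.quadraticTwist (NumberField.discr K : ℚ)).sha) = 0 := by
        intro c
        have hc : (c : ↥(W.quadraticTwist (NumberField.discr K : ℚ)).sha) ∈
            AddCommGroup.primaryComponent (↥(W.quadraticTwist (NumberField.discr K : ℚ)).sha) 2 :=
          (AddCommGroup.mem_primaryComponent).2 ⟨1, by rw [pow_one, ← natCast_zsmul]; exact mem_torsionBy_iff.mp c.2⟩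
        rwa [hbotT, AddSubgroup.mem_bot] at hc
      rw [hmem a, hmem b]
    omega
  -- ### (c) the frame of `T₀ ⊗ K`: no `2`-torsion, rank `≤ 1`, the anti-invariant point of infinite order
  have hrkTK : ((W.quadraticTwist (NumberField.discr K : ℚ)).baseChange K).mordellWeilRank ≤ 1 := by
    haveI : Module.Finite ℤ ((W.quadraticTwist (NumberField.discr K : ℚ)).baseChange K).toAffine.Point :=
      ((W.quadraticTwist (NumberField.discr K : ℚ)).baseChange K).module_finite_point_holds
    rw [(W.quadraticTwist (NumberField.discr K : ℚ)).mordellWeilRank_baseChange_of_finrank_eq_two_of_finite K h2, hrkT0, hrkX]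
  obtain ⟨C₁, hC₁⟩ := W.exists_variableChange_quadraticTwist_one
  have h2torsT : ∀ P : ((W.quadraticTwist (NumberField.discr K : ℚ)).baseChange K).toAffine.Point, (2 : ℤ) • P = 0 → P = 0 := by
    intro P hP
    let eK : ((W.quadraticTwist (NumberField.discr K : ℚ)).baseChange K).toAffine.Point ≃+ (W.baseChange K).toAffine.Point :=
      ((VariableChange.pointEquiv ((W.quadraticTwist (NumberField.discr K : ℚ)).baseChange K) (twistUntwist hθQ)).trans
        (Affine.Point.congrEquiv (twistUntwist_smul_baseChange W hθQ hθ2))).trans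
        ((Affine.Point.congrEquiv (congrArg (fun V : WeierstrassCurve ℚ ↦ V.baseChange K) hC₁.symm)).trans
          (VariableChange.pointEquivBaseChange W C₁ K).symm)
    have h := h2K (eK P) (by rw [← map_zsmul, hP, map_zero])
    exact eK.injective (h.trans (map_zero eK).symm)
  -- the frame point: the twist of `Q`, anti-invariant of infinite order
  have hτθ' : (τ : K →ₐ[ℚ] K) θ = -θ := hτθ
  obtain ⟨y, hy_inf, hyanti⟩ := exists_antiInvariant_twist_point_of_not_isOfFinAddOrder W hθQ hθ2 hdK hτθ' hQ
  have hanti : IsOfFinAddOrder (Affine.Point.map (W' := W.quadraticTwist (NumberField.discr K : ℚ)) (τ : K →ₐ[ℚ] K) y + y) := by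
    rw [hyanti, neg_add_cancel]
    exact IsOfFinAddOrder.zero
  haveI : Module.Finite ℤ ((W.quadraticTwist (NumberField.discr K : ℚ)).baseChange K).toAffine.Point :=
    ((W.quadraticTwist (NumberField.discr K : ℚ)).baseChange K).module_finite_point_holds
  obtain ⟨M, -, hndiv'⟩ := exists_pow_smul_eq_and_not_of_not_isOfFinAddOrder Nat.prime_two hy_inf
  have hndiv : ∀ Q' : ((W.quadraticTwist (NumberField.discr K : ℚ)).baseChange K).toAffine.Point, ((2 ^ (M + 1) : ℕ) : ℤ) • Q' ≠ y :=
    fun Q' h ↦ hndiv' ⟨Q', h⟩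
  -- ### (d) the two budgets: twin side for `T₀` (the route's), model-free core for `X' = D • W`
  have hgoodX : ∀ p : ℕ, p.Prime → ¬ (p : ℤ) ∣ NumberField.discr K → ((Ideal.span {(p : ℤ)}).primesOver (𝓞 K)).ncard ≠ 2 →
      ((W.quadraticTwist (NumberField.discr K : ℚ)).quadraticTwist (NumberField.discr K : ℚ)).HasGoodReductionAt (Matsuno2009.primePlace p) := by
    intro p hp _ hns
    rw [hD]
    exact (hasGoodReductionAt_smul_iff_holds (Matsuno2009.primePlace p) W D).mpr
      (hasGoodReductionAt_primePlace_of_ncard_ne_two W K hHe hp hns)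
  have hprodX : ∏ p ∈ (NumberField.discr K).natAbs.primeFactors,
      Nat.card {P : (((W.quadraticTwist (NumberField.discr K : ℚ)).quadraticTwist (NumberField.discr K : ℚ)).baseChange
        ((Matsuno2009.primePlace p).adicCompletion ℚ)).toAffine.Point // 2 • P = 0} = 2 ^ padicValNat 2 Wd.tamagawaProduct := by
    rw [← prod_ncard_roots_add_one_eq_two_pow_padicValNat_tamagawaProduct_twin W hIQ hodd hHe hT Cd hWd]
    refine Finset.prod_congr rfl fun p hp ↦ ?_
    obtain ⟨hpr, hpdvd, -⟩ := Nat.mem_primeFactors.mp hp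
    have hpd : (p : ℤ) ∣ NumberField.discr K := Int.natCast_dvd.mpr hpdvd
    have hp2 : p ≠ 2 := by
      rintro rfl
      obtain ⟨r, hr⟩ := hodd
      omega
    haveI := Fact.mk hpr
    rw [natCard_twoTorsion_baseChange_eq_of_smul D hD ((Matsuno2009.primePlace p).adicCompletion ℚ),
      natCard_twoTorsion_adicCompletion_eq_padic W (Matsuno2009.primePlace p) (Matsuno2009.natCast_mem_primePlace hpr)]
    exact GenusKolyTwin.natCard_twoTorsion_padic_eq W hp2
      (not_dvd_minimalDiscriminantInt_of_dvd_discr_of_heegner W K hIQ.1 hHe hpr hp2 hpd)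
  have heqT : padicValNat 2 (W.quadraticTwist (NumberField.discr K : ℚ)).tamagawaProduct = padicValNat 2 Wd.tamagawaProduct := by
    have h1 := prod_ncard_roots_add_one_eq_two_pow_padicValNat_tamagawaProduct_twin W hIQ hodd hHe hT
      (Wd := W.quadraticTwist (NumberField.discr K : ℚ)) 1 (one_smul _ _)
    have h2' := prod_ncard_roots_add_one_eq_two_pow_padicValNat_tamagawaProduct_twin W hIQ hodd hHe hT Cd hWd
    exact Nat.pow_right_injective le_rfl (h1.symm.trans h2')
  have hbud :
      ((W.quadraticTwist (NumberField.discr K : ℚ)).sha).relIndex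
          ((((W.quadraticTwist (NumberField.discr K : ℚ)).baseChange K).sha).comap
            (resBaseChange (W.quadraticTwist (NumberField.discr K : ℚ)) K)) ≠ 0 ∧
      (((W.quadraticTwist (NumberField.discr K : ℚ)).quadraticTwist (NumberField.discr K : ℚ)).sha).relIndex
          (((((W.quadraticTwist (NumberField.discr K : ℚ)).quadraticTwist (NumberField.discr K : ℚ)).baseChange K).sha).comap
            (resBaseChange ((W.quadraticTwist (NumberField.discr K : ℚ)).quadraticTwist (NumberField.discr K : ℚ)) K)) ≠ 0 ∧
      ((W.quadraticTwist (NumberField.discr K : ℚ)).sha).relIndex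
          ((((W.quadraticTwist (NumberField.discr K : ℚ)).baseChange K).sha).comap
            (resBaseChange (W.quadraticTwist (NumberField.discr K : ℚ)) K)) *
        (((W.quadraticTwist (NumberField.discr K : ℚ)).quadraticTwist (NumberField.discr K : ℚ)).sha).relIndex
          (((((W.quadraticTwist (NumberField.discr K : ℚ)).quadraticTwist (NumberField.discr K : ℚ)).baseChange K).sha).comap
            (resBaseChange ((W.quadraticTwist (NumberField.discr K : ℚ)).quadraticTwist (NumberField.discr K : ℚ)) K)) ≤ 4 := by
    rcases hbudget with ⟨hneg, hDEF⟩ | hDEF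
    · -- `Δ < 0`, `ord₂ C(Wd) ≤ 1`
      obtain ⟨hneT, hleT⟩ := relIndex_sha_comap_resBaseChange_twin_le_two_pow W (K := K) hneg hIQ hodd hHe hT
        (Wd := W.quadraticTwist (NumberField.discr K : ℚ)) 1 (one_smul _ _)
      rw [heqT] at hleT
      have hneX := relIndex_sha_relaxed_ne_zero ((W.quadraticTwist (NumberField.discr K : ℚ)).quadraticTwist (NumberField.discr K : ℚ))
        K h2 hodd hgoodX
      have hleX := relIndex_sha_relaxed_le_prod_natCard_twoTorsion
        ((W.quadraticTwist (NumberField.discr K : ℚ)).quadraticTwist (NumberField.discr K : ℚ)) K h2 hodd hgoodX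
      have hΔX : ((W.quadraticTwist (NumberField.discr K : ℚ)).quadraticTwist (NumberField.discr K : ℚ)).Δ < 0 := by
        rw [hD, variableChange_Δ]
        have h1 : (0 : ℚ) < ((D.u⁻¹ : ℚˣ) : ℚ) ^ 12 := Even.pow_pos (by norm_num) (Units.ne_zero _)
        nlinarith [mul_pos h1 (neg_pos.mpr hneg)]
      rw [comap_resBaseChange_sha_inf_iInf_eq_of_Δ_neg _ K hΔX] at hneX hleX
      rw [hprodX] at hleX
      refine ⟨hneT, hneX, ?_⟩
      have h22 : 2 ^ padicValNat 2 Wd.tamagawaProduct ≤ 2 :=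
        calc 2 ^ padicValNat 2 Wd.tamagawaProduct ≤ 2 ^ 1 := Nat.pow_le_pow_right (by norm_num) hDEF
          _ = 2 := pow_one 2
      calc _ ≤ 2 ^ padicValNat 2 Wd.tamagawaProduct * 2 ^ padicValNat 2 Wd.tamagawaProduct := Nat.mul_le_mul hleT hleX
        _ ≤ 2 * 2 := Nat.mul_le_mul h22 h22
    · -- any sign, `ord₂ C(Wd) = 0`: the archimedean bit
      obtain ⟨hneT, hleT⟩ := relIndex_sha_comap_resBaseChange_twin_le_two_pow_succ_of_arch W K hIQ hodd hHe hT
        (Wd := W.quadraticTwist (NumberField.discr K : ℚ)) 1 (one_smul _ _)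
        (archimedeanBit_sha_comap_resBaseChange (W.quadraticTwist (NumberField.discr K : ℚ)) K)
      rw [heqT, hDEF, zero_add, pow_one] at hleT
      obtain ⟨hneX, hleX⟩ := relIndex_sha_comap_resBaseChange_le_of_arch K
        ((W.quadraticTwist (NumberField.discr K : ℚ)).quadraticTwist (NumberField.discr K : ℚ)) h2 hodd hgoodX
        (archimedeanBit_sha_comap_resBaseChange _ K)
      rw [hprodX, hDEF, pow_zero, mul_one] at hleX
      exact ⟨hneT, hneX, Nat.mul_le_mul hleT hleX⟩
  obtain ⟨hne, hneT', hbud4⟩ := hbud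
  -- ### (e) the sandwich for the base `T₀`: `#Ш(T₀/K)[2^∞] ∣ 4^0`
  obtain ⟨hfinTK, hdvd⟩ := natCard_sha_dvd_pow_of_pair_of_frame (W.quadraticTwist (NumberField.discr K : ℚ)) K hIQ hτ1 h2torsT
    hrkTK y M hndiv hanti hT0 hne hneT' hbud4 hexp h4
  rw [mul_zero, pow_zero, Nat.dvd_one] at hdvd
  -- ### (f) transport along `Ψ : H¹(K, T₀) ≃ H¹(K, E)`
  haveI := hfinTK
  obtain ⟨Ψ, hΨ, -, -, -⟩ := exists_galH1_twistTransport W K h2 hθQ hθ2 τ hτ1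
  obtain ⟨hfin, hcard⟩ := finite_and_natCard_primaryComponent_eq_of_addEquiv Ψ
    (((W.quadraticTwist (NumberField.discr K : ℚ)).baseChange K).sha) ((W.baseChange K).sha) hΨ 2
  exact ⟨hfin, hcard.trans hdvd⟩

/-! ## §2 All inputs on the `ℚ`-side; the habitat form -/

/-- **THE SWAPPED PAIR SANDWICH, all inputs on the `ℚ`-side** — `E(K)[2] = 0` DISCHARGED: `#Sel₂(E) = 2` with `rank E(ℚ) ≥ 1` already gives
`E(ℚ)[2] = 0` (descent count), hence `E(K)[2] = 0` (`forall_two_zsmul_baseChange_eq_zero_of_heegner`).  `W/ℚ` globally minimal with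
`C(W)` odd; `K` imaginary quadratic, `d_K` odd, Heegner for `N_W`; `rank E(ℚ) ≥ 1`, `#Sel₂(E) = 2`; `Wd = Cd • W^(d_K)` elliptic with
`#Sel₂(Wd) = 1`; budget `(Δ_W < 0 ∧ ord₂ C(Wd) ≤ 1) ∨ ord₂ C(Wd) = 0`.  Then **`#Ш(E/K)[2^∞] = 1`** (finite).  This is the K-side
exactness input of LINE 23's swapped pair at depth zero: with it, Kolyvagin exactness `#Ш(E/K)[2^∞] = 4^(M₀)` on this frame is
EQUIVALENT to `M₀ = 0`.  Unconditional.  [cite: Kramer1981, Thm. 1 and §2 Prop. 3] [cite: GrossLMS1991, §5 (5.1)–(5.3)]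
[cite: SilvermanAEC2009, X.5 Cor. 5.4, Thm. X.4.2] -/
theorem natCard_primaryComponent_sha_baseChange_two_eq_one_of_swappedPair
    (hT : Odd W.tamagawaProduct) (hIQ : IsImaginaryQuadratic K) (hodd : Odd (NumberField.discr K))
    (hHe : SatisfiesHeegnerHypothesis (W.conductorNorm ℤ) K)
    (hrk : 1 ≤ W.mordellWeilRank) (hSel : Nat.card (W.selmerGroup 2) = 2)
    {Wd : WeierstrassCurve ℚ} [Wd.IsElliptic] (Cd : VariableChange ℚ) (hWd : Cd • W.quadraticTwist (NumberField.discr K : ℚ) = Wd)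
    (hSel1 : Nat.card (Wd.selmerGroup 2) = 1)
    (hbudget : (W.Δ < 0 ∧ padicValNat 2 Wd.tamagawaProduct ≤ 1) ∨ padicValNat 2 Wd.tamagawaProduct = 0) :
    Finite (AddCommGroup.primaryComponent (↥(W.baseChange K).sha) 2) ∧
      Nat.card (AddCommGroup.primaryComponent (↥(W.baseChange K).sha) 2) = 1 := by
  -- `E(ℚ)[2] = 0` from the descent count (the generic lemma's instance of the group law on `E(ℚ)`; realigned by `convert`)
  obtain ⟨-, hT2, -⟩ := rank_eq_one_and_sha_primary_eq_zero_of_natCard_selmerGroup_eq_two W hSel hrk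
  exact finite_and_natCard_primaryComponent_sha_baseChange_two_eq_one_of_swappedPair W K hT hIQ hodd hHe
    (forall_two_zsmul_baseChange_eq_zero_of_heegner W K hIQ hodd hHe (fun P hP ↦ by convert hT2 P (by convert hP)))
    hrk hSel Cd hWd hSel1 hbudget

/-- **Habitat form**: the same with `E(K)[2] = 0` discharged from `ρ̄_{E,2}` onto (the route's habitat binder), no Heegner hypothesis needed
for that step.  [cite: SilvermanAEC2009, Thm. X.4.2] -/
theorem natCard_primaryComponent_sha_baseChange_two_eq_one_of_swappedPair_of_hasSurjectiveModNGaloisRep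
    (hT : Odd W.tamagawaProduct) (hIQ : IsImaginaryQuadratic K) (hodd : Odd (NumberField.discr K))
    (hHe : SatisfiesHeegnerHypothesis (W.conductorNorm ℤ) K) (hs2 : W.HasSurjectiveModNGaloisRep 2)
    (hrk : 1 ≤ W.mordellWeilRank) (hSel : Nat.card (W.selmerGroup 2) = 2)
    {Wd : WeierstrassCurve ℚ} [Wd.IsElliptic] (Cd : VariableChange ℚ) (hWd : Cd • W.quadraticTwist (NumberField.discr K : ℚ) = Wd)
    (hSel1 : Nat.card (Wd.selmerGroup 2) = 1)
    (hbudget : (W.Δ < 0 ∧ padicValNat 2 Wd.tamagawaProduct ≤ 1) ∨ padicValNat 2 Wd.tamagawaProduct = 0) :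
    Finite (AddCommGroup.primaryComponent (↥(W.baseChange K).sha) 2) ∧
      Nat.card (AddCommGroup.primaryComponent (↥(W.baseChange K).sha) 2) = 1 :=
  finite_and_natCard_primaryComponent_sha_baseChange_two_eq_one_of_swappedPair W K hT hIQ hodd hHe
    (fun P hP ↦ EigenClassesFinite.forall_zsmul_two_pow_baseChange_eq_zero_of_hasSurjectiveModNGaloisRep_two W K hIQ.1 hs2 1 P
      (by simpa using hP)) hrk hSel Cd hWd hSel1 hbudget

end Swapped

end Summit.BirchSwinnertonDyer.BirchSwinnertonDyer.Theorems.GenusExact.TwinSwap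

end
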